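import Mathlib
import Summits.HodgeConjecture.HodgeConjecture.Theorems.WeilClassTestFormatFiveThreeCrossPlusTwoReducedEE
import Summits.HodgeConjecture.HodgeConjecture.Theorems.WeilClassTestFormatFiveThreeCrossPlusTwoAggregates
import Summits.HodgeConjecture.HodgeConjecture.Theorems.WeilClassTestFormatFiveThreeCrossPlusOne
import Summits.HodgeConjecture.HodgeConjecture.Theorems.WeilClassTestFormatFiveThreeGeneralGauge

/-!
# Conjecture N (hodge-weil ladder, GAPS G51b), format (5,3): CONJECTURE N ON CROSS + TWO FREE E-ROOTS (the k = 2 EE stratum), WITH (P1)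

Prover 2, generation 29 (note `run/shared/lean/b2b/hodge-weil/b2b-hweil-pv2-g29/EE-REDUCED-G29.md`). Setting of `CONJECTURE-N.md` §1, format (5,3),
centred real coordinates, `G = Q₂ + Q₄`. pv2-g21 proved `G ≥ 0` on every cross, pv2-g22 on 'cross + one free root' (`…CrossPlusOne.conjectureN_53_cross_plus_one`).
THIS FILE: six roots `E₃, E₄, E₅, F₁, F₂, F₃` on the two null lines through a base point and TWO E-roots `E₁, E₂` FREE, pure (`P1 = P2 = P4 = 0`) ⟹ `G ≥ 0`
— Conjecture N on the k = 2 EE stratum of pv2-g23/g24's programme, whose piece `{h_p = 0}` needed the t-endpoint reduction (pv2-g24), the exits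
(pv2-g24…g28) and the degree-8 Positivstellensatz certificate of the double corner (pv2-g26/g27, replayed by `native_decide` in pv2-g28). Chain:
`…GeneralGauge.G_gauge_general` (value of `G`, pv2-g23) → `…CrossPlusTwoAggregates` (S, P2, P4, K in aggregate form) → Cauchy–Schwarz for the corner
measures of the six on-cross roots (`cauchy_schwarz_H2/V2`) → `aggregate_cross_plus_two_EE` ⟸ `…CrossPlusTwoReducedEE.reduced_cross_plus_two_EE`
(endpoint principle on the purity line) ⟸ `…CrossPlusTwoPieceEE.piece_EE` and its mirror image. **`conjectureN_53_cross_plus_two_EE`** has the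
hypotheses of `conjectureN_53_cross_plus_one` with `x₂·y₂ = 0` deleted. COMPUTATIONAL (inherits `Lean.ofReduceBool` from the double-corner certificate).
Pure real algebra; nothing here is a case of HC, a rung or a door edge; no statement of Markman's papers is used; COUNT of record unchanged. New cell result ⇒ Summits/.
-/

set_option linter.dupNamespace false
set_option maxRecDepth 16384

namespace Summit.HodgeConjecture.HodgeConjecture.WeilClassTestFormatFiveThreeCrossPlusTwoEE

open Summit.HodgeConjecture.HodgeConjecture.WeilClassTestFormatFiveThreeCrossPlusOne (Mo_corner T_corner)
open Summit.HodgeConjecture.HodgeConjecture.WeilClassTestFormatFiveThreeCrossPlusTwoAggregates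
open Summit.HodgeConjecture.HodgeConjecture.WeilClassTestFormatFiveThreeCrossPlusTwoReducedEE (reduced_cross_plus_two_EE)
open Summit.HodgeConjecture.HodgeConjecture.WeilClassTestFormatFiveThreeGeneralGauge (G_gauge_general)

/-- Cauchy–Schwarz for the H-axis corner measure of the six on-cross roots (`ν = Σ_{e≥3} x_e δ_{x_e} + Σ_g p_g δ_{−p_g} ≥ 0`): `ν(t)² ≤ ν(1)·ν(t²)`, i.e. `(D⁺ − x₁² − x₂²)² ≤ (X − x₁ − x₂)(C₃⁺ − x₁³ − x₂³)`. -/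
theorem cauchy_schwarz_H2 (x₁ x₂ x₃ x₄ x₅ p₁ p₂ p₃ : ℝ) (hx₃ : 0 ≤ x₃) (hx₄ : 0 ≤ x₄) (hx₅ : 0 ≤ x₅) (hp₁ : 0 ≤ p₁) (hp₂ : 0 ≤ p₂) (hp₃ : 0 ≤ p₃) :
    (((x₁ ^ 2 + x₂ ^ 2 + x₃ ^ 2 + x₄ ^ 2 + x₅ ^ 2) - (p₁ ^ 2 + p₂ ^ 2 + p₃ ^ 2)) - x₁ ^ 2 - x₂ ^ 2) ^ 2 ≤ ((x₁ + x₂ + x₃ + x₄ + x₅ + p₁ + p₂ + p₃) - x₁ - x₂) * (((x₁ ^ 3 + x₂ ^ 3 + x₃ ^ 3 + x₄ ^ 3 + x₅ ^ 3) + (p₁ ^ 3 + p₂ ^ 3 + p₃ ^ 3)) - x₁ ^ 3 - x₂ ^ 3) := by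
  have e : ((x₁ + x₂ + x₃ + x₄ + x₅ + p₁ + p₂ + p₃) - x₁ - x₂) * (((x₁ ^ 3 + x₂ ^ 3 + x₃ ^ 3 + x₄ ^ 3 + x₅ ^ 3) + (p₁ ^ 3 + p₂ ^ 3 + p₃ ^ 3)) - x₁ ^ 3 - x₂ ^ 3) - (((x₁ ^ 2 + x₂ ^ 2 + x₃ ^ 2 + x₄ ^ 2 + x₅ ^ 2) - (p₁ ^ 2 + p₂ ^ 2 + p₃ ^ 2)) - x₁ ^ 2 - x₂ ^ 2) ^ 2
      = x₃ * x₄ * (x₃ - x₄) ^ 2 + x₃ * x₅ * (x₃ - x₅) ^ 2 + x₃ * p₁ * (x₃ - (-p₁)) ^ 2 + x₃ * p₂ * (x₃ - (-p₂)) ^ 2 + x₃ * p₃ * (x₃ - (-p₃)) ^ 2 + x₄ * x₅ * (x₄ - x₅) ^ 2 + x₄ * p₁ * (x₄ - (-p₁)) ^ 2 + x₄ * p₂ * (x₄ - (-p₂)) ^ 2 + x₄ * p₃ * (x₄ - (-p₃)) ^ 2 + x₅ * p₁ * (x₅ - (-p₁)) ^ 2 + x₅ * p₂ * (x₅ - (-p₂))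 ^ 2 + x₅ * p₃ * (x₅ - (-p₃)) ^ 2 + p₁ * p₂ * ((-p₁) - (-p₂)) ^ 2 + p₁ * p₃ * ((-p₁) - (-p₃)) ^ 2 + p₂ * p₃ * ((-p₂) - (-p₃)) ^ 2 := by ring
  have h : 0 ≤ x₃ * x₄ * (x₃ - x₄) ^ 2 + x₃ * x₅ * (x₃ - x₅) ^ 2 + x₃ * p₁ * (x₃ - (-p₁)) ^ 2 + x₃ * p₂ * (x₃ - (-p₂)) ^ 2 + x₃ * p₃ * (x₃ - (-p₃)) ^ 2 + x₄ * x₅ * (x₄ - x₅) ^ 2 + x₄ * p₁ * (x₄ - (-p₁)) ^ 2 + x₄ * p₂ * (x₄ - (-p₂)) ^ 2 + x₄ * p₃ * (x₄ - (-p₃)) ^ 2 + x₅ * p₁ * (x₅ - (-p₁)) ^ 2 + x₅ * p₂ * (x₅ - (-p₂)) ^ 2 + x₅ * p₃ * (x₅ - (-p₃)) ^ 2 + p₁ * p₂ * ((-p₁) - (-p₂)) ^ 2 + p₁ * p₃ * ((-p₁) - (-p₃)) ^ 2 + p₂ * p₃ * ((-p₂) - (-p₃)) ^ 2 := by positiv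ity
  linarith

/-- Cauchy–Schwarz for the V-axis corner measure of the six on-cross roots: `(D⁻ − y₁² − y₂²)² ≤ (M − y₁ − y₂)(C₃⁻ − y₁³ − y₂³)`. -/
theorem cauchy_schwarz_V2 (y₁ y₂ y₃ y₄ y₅ q₁ q₂ q₃ : ℝ) (hy₃ : 0 ≤ y₃) (hy₄ : 0 ≤ y₄) (hy₅ : 0 ≤ y₅) (hq₁ : 0 ≤ q₁) (hq₂ : 0 ≤ q₂) (hq₃ : 0 ≤ q₃) :
    (((y₁ ^ 2 + y₂ ^ 2 + y₃ ^ 2 + y₄ ^ 2 + y₅ ^ 2) - (q₁ ^ 2 + q₂ ^ 2 + q₃ ^ 2)) - y₁ ^ 2 - y₂ ^ 2) ^ 2 ≤ ((y₁ + y₂ + y₃ + y₄ + y₅ + q₁ + q₂ + q₃) - y₁ - y₂) * (((y₁ ^ 3 + y₂ ^ 3 + y₃ ^ 3 + y₄ ^ 3 + y₅ ^ 3) + (q₁ ^ 3 + q₂ ^ 3 + q₃ ^ 3)) - y₁ ^ 3 - y₂ ^ 3) := by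
  have e : ((y₁ + y₂ + y₃ + y₄ + y₅ + q₁ + q₂ + q₃) - y₁ - y₂) * (((y₁ ^ 3 + y₂ ^ 3 + y₃ ^ 3 + y₄ ^ 3 + y₅ ^ 3) + (q₁ ^ 3 + q₂ ^ 3 + q₃ ^ 3)) - y₁ ^ 3 - y₂ ^ 3) - (((y₁ ^ 2 + y₂ ^ 2 + y₃ ^ 2 + y₄ ^ 2 + y₅ ^ 2) - (q₁ ^ 2 + q₂ ^ 2 + q₃ ^ 2)) - y₁ ^ 2 - y₂ ^ 2) ^ 2
      = y₃ * y₄ * (y₃ - y₄) ^ 2 + y₃ * y₅ * (y₃ - y₅) ^ 2 + y₃ * q₁ * (y₃ - (-q₁)) ^ 2 + y₃ * q₂ * (y₃ - (-q₂)) ^ 2 + y₃ * q₃ * (y₃ - (-q₃)) ^ 2 + y₄ * y₅ * (y₄ - y₅) ^ 2 + y₄ * q₁ * (y₄ - (-q₁)) ^ 2 + y₄ * q₂ * (y₄ - (-q₂)) ^ 2 + y₄ * q₃ * (y₄ - (-q₃)) ^ 2 + y₅ * q₁ * (y₅ - (-q₁)) ^ 2 + y₅ * q₂ * (y₅ - (-q₂))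 ^ 2 + y₅ * q₃ * (y₅ - (-q₃)) ^ 2 + q₁ * q₂ * ((-q₁) - (-q₂)) ^ 2 + q₁ * q₃ * ((-q₁) - (-q₃)) ^ 2 + q₂ * q₃ * ((-q₂) - (-q₃)) ^ 2 := by ring
  have h : 0 ≤ y₃ * y₄ * (y₃ - y₄) ^ 2 + y₃ * y₅ * (y₃ - y₅) ^ 2 + y₃ * q₁ * (y₃ - (-q₁)) ^ 2 + y₃ * q₂ * (y₃ - (-q₂)) ^ 2 + y₃ * q₃ * (y₃ - (-q₃)) ^ 2 + y₄ * y₅ * (y₄ - y₅) ^ 2 + y₄ * q₁ * (y₄ - (-q₁)) ^ 2 + y₄ * q₂ * (y₄ - (-q₂)) ^ 2 + y₄ * q₃ * (y₄ - (-q₃)) ^ 2 + y₅ * q₁ * (y₅ - (-q₁)) ^ 2 + y₅ * q₂ * (y₅ - (-q₂)) ^ 2 + y₅ * q₃ * (y₅ - (-q₃)) ^ 2 + q₁ * q₂ * ((-q₁) - (-q₂)) ^ 2 + q₁ * q₃ * ((-q₁) - (-q₃)) ^ 2 + q₂ * q₃ * ((-q₂) - (-q₃)) ^ 2 := by positiv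ity
  linarith

set_option maxHeartbeats 4000000 in
/-- AGGREGATE FORM of the k = 2 EE stratum. For reals `X, M, D⁺, D⁻, C₃⁺, C₃⁻, x₁, y₁, x₂, y₂, us` with `2us = M − X`, `x_i, y_i ≥ 0`, `X − x₁ − x₂ ≥ 0`,
`M − y₁ − y₂ ≥ 0`, the purity relations `P2 = P4 = 0` and `K = P4 − P1 = 0` in aggregate form and the two Cauchy–Schwarz inequalities for the on-cross
corner measures, the gauge value of `G` (pv2-g23 `G_gauge_general` with the two defects `x₁y₁`, `x₂y₂`) is `≥ 0` — by `reduced_cross_plus_two_EE` in the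
variables `X1 = X − x₁ − x₂`, `M1 = M − y₁ − y₂`, `D1 = D⁺ − x₁² − x₂²`, `E1 = D⁻ − y₁² − y₂²` (the purity sums express `C₃±` through the other aggregates:
`2h_p = 2[(X−x₁−x₂)(C₃⁺−x₁³−x₂³) − (D⁺−x₁²−x₂²)²] − (X−x₁−x₂)(P2 + P4)`, mirror for `2h_m`). -/
theorem aggregate_cross_plus_two_EE (X M Dp Dm Cp Cm x₁ y₁ x₂ y₂ us : ℝ) (hus : 2 * us = M - X)
    (hx₁ : 0 ≤ x₁) (hy₁ : 0 ≤ y₁) (hx₂ : 0 ≤ x₂) (hy₂ : 0 ≤ y₂) (hX1 : 0 ≤ X - x₁ - x₂) (hM1 : 0 ≤ M - y₁ - y₂)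
    (hP2 : -(1:ℝ)*x₂*y₂^(2:ℕ) - (1:ℝ)*x₂^(2:ℕ)*y₂ - (1:ℝ)*x₁*y₁^(2:ℕ) - (1:ℝ)*x₁^(2:ℕ)*y₁ + (1:ℝ)*M*x₂*y₂ + (1:ℝ)*M*x₁*y₁ + ((1:ℝ)/(2:ℝ))*M^(3:ℕ) + (1:ℝ)*X*x₂*y₂ + (1:ℝ)*X*x₁*y₁ - ((1:ℝ)/(2:ℝ))*X*M^(2:ℕ) - ((1:ℝ)/(2:ℝ))*X^(2:ℕ)*M + ((1:ℝ)/(2:ℝ))*X^(3:ℕ) - ((3:ℝ)/(2:ℝ))*M*Dm + ((1:ℝ)/(2:ℝ))*M*Dp + ((1:ℝ)/(2:ℝ))*X*Dm - ((3:ℝ)/(2:ℝ))*X*Dp + (1:ℝ)*Cm + (1:ℝ)*Cp = 0)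
    (hP4 : (3:ℝ)*x₂*y₂^(2:ℕ) - (3:ℝ)*x₂^(2:ℕ)*y₂ + (3:ℝ)*x₁*y₁^(2:ℕ) - (3:ℝ)*x₁^(2:ℕ)*y₁ - (3:ℝ)*M*x₂*y₂ - (3:ℝ)*M*x₁*y₁ - ((1:ℝ)/(2:ℝ))*M^(3:ℕ) + (3:ℝ)*X*x₂*y₂ + (3:ℝ)*X*x₁*y₁ + ((3:ℝ)/(2:ℝ))*X*M^(2:ℕ) - ((3:ℝ)/(2:ℝ))*X^(2:ℕ)*M + ((1:ℝ)/(2:ℝ))*X^(3:ℕ) + ((3:ℝ)/(2:ℝ))*M*Dm + ((3:ℝ)/(2:ℝ))*M*Dp - ((3:ℝ)/(2:ℝ))*X*Dm - ((3:ℝ)/(2:ℝ))*X*Dp - (1:ℝ)*Cm + (1:ℝ)*Cp = 0)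
    (hK : (4:ℝ)*x₂*y₂^(2:ℕ) - (4:ℝ)*x₂^(2:ℕ)*y₂ + (4:ℝ)*x₁*y₁^(2:ℕ) - (4:ℝ)*x₁^(2:ℕ)*y₁ - (4:ℝ)*M*x₂*y₂ - (4:ℝ)*M*x₁*y₁ + (4:ℝ)*X*x₂*y₂ + (4:ℝ)*X*x₁*y₁ + (2:ℝ)*X*M^(2:ℕ) - (2:ℝ)*X^(2:ℕ)*M + (2:ℝ)*M*Dp - (2:ℝ)*X*Dm = 0)
    (hCSp : ((Dp) - x₁ ^ 2 - x₂ ^ 2) ^ 2 ≤ ((X) - x₁ - x₂) * ((Cp) - x₁ ^ 3 - x₂ ^ 3))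
    (hCSm : ((Dm) - y₁ ^ 2 - y₂ ^ 2) ^ 2 ≤ ((M) - y₁ - y₂) * ((Cm) - y₁ ^ 3 - y₂ ^ 3)) :
    0 ≤ (us * (X + M) + (Dp - Dm)) ^ 2 + ((-(2:ℝ)*x₂*y₂ - (2:ℝ)*x₁*y₁ - ((1:ℝ)/(2:ℝ))*M^(2:ℕ) + (1:ℝ)*X*M - ((1:ℝ)/(2:ℝ))*X^(2:ℕ) + (1:ℝ)*Dm + (1:ℝ)*Dp) / 2) * (X + M) ^ 2 - (-(2:ℝ)*x₂*y₂ - (2:ℝ)*x₁*y₁ - ((1:ℝ)/(2:ℝ))*M^(2:ℕ) + (1:ℝ)*X*M - ((1:ℝ)/(2:ℝ))*X^(2:ℕ) + (1:ℝ)*Dm + (1:ℝ)*Dp) ^ 2 - 2 * (-(2:ℝ)*x₂*y₂ - (2:ℝ)*x₁*y₁ - ((1:ℝ)/(2:ℝ))*M^(2:ℕ) + (1:ℝ)*X*M - ((1:ℝ)/(2:ℝ))*X^(2:ℕ) + (1:ℝ)*Dm + (1:ℝ)*Dp) * us ^ 2 - 4 * (x₁ * y₁) * (3 * ((us + x₁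 - y₁) ^ 2 - (-(2:ℝ)*x₂*y₂ - (2:ℝ)*x₁*y₁ - ((1:ℝ)/(2:ℝ))*M^(2:ℕ) + (1:ℝ)*X*M - ((1:ℝ)/(2:ℝ))*X^(2:ℕ) + (1:ℝ)*Dm + (1:ℝ)*Dp) / 2) + (-(2:ℝ)*x₂*y₂ - (2:ℝ)*x₁*y₁ - ((1:ℝ)/(2:ℝ))*M^(2:ℕ) + (1:ℝ)*X*M - ((1:ℝ)/(2:ℝ))*X^(2:ℕ) + (1:ℝ)*Dm + (1:ℝ)*Dp)) - 4 * (x₂ * y₂) * (3 * ((us + x₂ - y₂) ^ 2 - (-(2:ℝ)*x₂*y₂ - (2:ℝ)*x₁*y₁ - ((1:ℝ)/(2:ℝ))*M^(2:ℕ) + (1:ℝ)*X*M - ((1:ℝ)/(2:ℝ))*X^(2:ℕ) + (1:ℝ)*Dm + (1:ℝ)*Dp) / 2) + (-(2:ℝ)*x₂*y₂ - (2:ℝ)*x₁*y₁ - ((1:ℝ)/(2:ℝ))*M^(2:ℕ) + (1:ℝ)*X*M - ((1:ℝ)/(2:ℝ))*X^(2:ℕ) + (1:ℝ)*Dm + (1:ℝ)*Dp))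 := by
  have hus' : us = (M - X) / 2 := by linarith
  subst hus'
  have hKr : (4:ℝ)*(M - y₁ - y₂)*y₁*x₂ + (4:ℝ)*(M - y₁ - y₂)*x₁*y₂ - (4:ℝ)*(M - y₁ - y₂)*x₁*x₂ + (2:ℝ)*(M - y₁ - y₂)^(2:ℕ)*x₂ + (2:ℝ)*(M - y₁ - y₂)^(2:ℕ)*x₁ + (4:ℝ)*(X - x₁ - x₂)*y₁*y₂ - (4:ℝ)*(X - x₁ - x₂)*y₁*x₂ - (4:ℝ)*(X - x₁ - x₂)*x₁*y₂ + (4:ℝ)*(X - x₁ - x₂)*(M - y₁ - y₂)*y₂ - (4:ℝ)*(X - x₁ - x₂)*(M - y₁ - y₂)*x₂ + (4:ℝ)*(X - x₁ - x₂)*(M - y₁ - y₂)*y₁ - (4:ℝ)*(X - x₁ - x₂)*(M - y₁ - y₂)*x₁ + (2:ℝ)*(X - x₁ - x₂)*(M - y₁ - y₂)^(2:ℕ) - (2:ℝ)*(X - x₁ - x₂)^(2:ℕ)*y₂ - (2:ℝ)*(X - x₁ - x₂)^(2:ℕ)*y₁ - (2:ℝ)*(X - x₁ - x₂)^(2:ℕ)*(M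 - y₁ - y₂) - (2:ℝ)*(Dm - y₁ ^ 2 - y₂ ^ 2)*x₂ - (2:ℝ)*(Dm - y₁ ^ 2 - y₂ ^ 2)*x₁ + (2:ℝ)*(Dp - x₁ ^ 2 - x₂ ^ 2)*y₂ + (2:ℝ)*(Dp - x₁ ^ 2 - x₂ ^ 2)*y₁ + (2:ℝ)*(M - y₁ - y₂)*(Dp - x₁ ^ 2 - x₂ ^ 2) - (2:ℝ)*(X - x₁ - x₂)*(Dm - y₁ ^ 2 - y₂ ^ 2) = 0 := by
    linear_combination hK
  have hpr : (0:ℝ) ≤ -(2:ℝ)*(X - x₁ - x₂)*(M - y₁ - y₂)*y₁*x₂ - (2:ℝ)*(X - x₁ - x₂)*(M - y₁ - y₂)*x₁*y₂ + (4:ℝ)*(X - x₁ - x₂)*(M - y₁ - y₂)*x₁*x₂ - (X - x₁ - x₂)*(M - y₁ - y₂)^(2:ℕ)*x₂ - (X - x₁ - x₂)*(M - y₁ - y₂)^(2:ℕ)*x₁ - (2:ℝ)*(X - x₁ - x₂)^(2:ℕ)*y₁*y₂ + (4:ℝ)*(X - x₁ - x₂)^(2:ℕ)*y₁*x₂ +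 (4:ℝ)*(X - x₁ - x₂)^(2:ℕ)*x₁*y₂ - (6:ℝ)*(X - x₁ - x₂)^(2:ℕ)*x₁*x₂ - (2:ℝ)*(X - x₁ - x₂)^(2:ℕ)*(M - y₁ - y₂)*y₂ + (4:ℝ)*(X - x₁ - x₂)^(2:ℕ)*(M - y₁ - y₂)*x₂ - (2:ℝ)*(X - x₁ - x₂)^(2:ℕ)*(M - y₁ - y₂)*y₁ + (4:ℝ)*(X - x₁ - x₂)^(2:ℕ)*(M - y₁ - y₂)*x₁ - (X - x₁ - x₂)^(2:ℕ)*(M - y₁ - y₂)^(2:ℕ) + (2:ℝ)*(X - x₁ - x₂)^(3:ℕ)*y₂ - (3:ℝ)*(X - x₁ - x₂)^(3:ℕ)*x₂ + (2:ℝ)*(X - x₁ - x₂)^(3:ℕ)*y₁ - (3:ℝ)*(X - x₁ - x₂)^(3:ℕ)*x₁ + (2:ℝ)*(X - x₁ - x₂)^(3:ℕ)*(M - y₁ - y₂) - (X - x₁ - x₂)^(4:ℕ) + (X - x₁ - x₂)*(Dm - y₁ ^ 2 - y₂ ^ 2)*x₂ + (X - x₁ - x₂)*(Dm - y₁ ^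 2 - y₂ ^ 2)*x₁ - (2:ℝ)*(X - x₁ - x₂)*(Dp - x₁ ^ 2 - x₂ ^ 2)*y₂ + (3:ℝ)*(X - x₁ - x₂)*(Dp - x₁ ^ 2 - x₂ ^ 2)*x₂ - (2:ℝ)*(X - x₁ - x₂)*(Dp - x₁ ^ 2 - x₂ ^ 2)*y₁ + (3:ℝ)*(X - x₁ - x₂)*(Dp - x₁ ^ 2 - x₂ ^ 2)*x₁ - (2:ℝ)*(X - x₁ - x₂)*(M - y₁ - y₂)*(Dp - x₁ ^ 2 - x₂ ^ 2) + (X - x₁ - x₂)^(2:ℕ)*(Dm - y₁ ^ 2 - y₂ ^ 2) + (3:ℝ)*(X - x₁ - x₂)^(2:ℕ)*(Dp - x₁ ^ 2 - x₂ ^ 2) - (2:ℝ)*(Dp - x₁ ^ 2 - x₂ ^ 2)^(2:ℕ) := by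
    have e : -(2:ℝ)*(X - x₁ - x₂)*(M - y₁ - y₂)*y₁*x₂ - (2:ℝ)*(X - x₁ - x₂)*(M - y₁ - y₂)*x₁*y₂ + (4:ℝ)*(X - x₁ - x₂)*(M - y₁ - y₂)*x₁*x₂ - (X - x₁ - x₂)*(M - y₁ - y₂)^(2:ℕ)*x₂ - (X - x₁ - x₂)*(M - y₁ - y₂)^(2:ℕ)*x₁ - (2:ℝ)*(X - x₁ - x₂)^(2:ℕ)*y₁*y₂ + (4:ℝ)*(X - x₁ - x₂)^(2:ℕ)*y₁*x₂ + (4:ℝ)*(X - x₁ - x₂)^(2:ℕ)*x₁*y₂ - (6:ℝ)*(X - x₁ - x₂)^(2:ℕ)*x₁*x₂ - (2:ℝ)*(X - x₁ - x₂)^(2:ℕ)*(M - y₁ - y₂)*y₂ + (4:ℝ)*(X - x₁ - x₂)^(2:ℕ)*(M - y₁ - y₂)*x₂ - (2:ℝ)*(X - x₁ - x₂)^(2:ℕ)*(M - y₁ - y₂)*y₁ + (4:ℝ)*(X - x₁ - x₂)^(2:ℕ)*(M - y₁ - y₂)*x₁ - (X - x₁ - x₂)^(2:ℕ)*(M - y₁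 - y₂)^(2:ℕ) + (2:ℝ)*(X - x₁ - x₂)^(3:ℕ)*y₂ - (3:ℝ)*(X - x₁ - x₂)^(3:ℕ)*x₂ + (2:ℝ)*(X - x₁ - x₂)^(3:ℕ)*y₁ - (3:ℝ)*(X - x₁ - x₂)^(3:ℕ)*x₁ + (2:ℝ)*(X - x₁ - x₂)^(3:ℕ)*(M - y₁ - y₂) - (X - x₁ - x₂)^(4:ℕ) + (X - x₁ - x₂)*(Dm - y₁ ^ 2 - y₂ ^ 2)*x₂ + (X - x₁ - x₂)*(Dm - y₁ ^ 2 - y₂ ^ 2)*x₁ - (2:ℝ)*(X - x₁ - x₂)*(Dp - x₁ ^ 2 - x₂ ^ 2)*y₂ + (3:ℝ)*(X - x₁ - x₂)*(Dp - x₁ ^ 2 - x₂ ^ 2)*x₂ - (2:ℝ)*(X - x₁ - x₂)*(Dp - x₁ ^ 2 - x₂ ^ 2)*y₁ + (3:ℝ)*(X - x₁ - x₂)*(Dp - x₁ ^ 2 - x₂ ^ 2)*x₁ - (2:ℝ)*(X - x₁ - x₂)*(M - y₁ - y₂)*(Dp - x₁ ^ 2 - x₂ ^ 2) + (X - x₁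 - x₂)^(2:ℕ)*(Dm - y₁ ^ 2 - y₂ ^ 2) + (3:ℝ)*(X - x₁ - x₂)^(2:ℕ)*(Dp - x₁ ^ 2 - x₂ ^ 2) - (2:ℝ)*(Dp - x₁ ^ 2 - x₂ ^ 2)^(2:ℕ)
        = 2 * ((X - x₁ - x₂) * (Cp - x₁ ^ 3 - x₂ ^ 3) - (Dp - x₁ ^ 2 - x₂ ^ 2) ^ 2) - (X - x₁ - x₂) * (-(1:ℝ)*x₂*y₂^(2:ℕ) - (1:ℝ)*x₂^(2:ℕ)*y₂ - (1:ℝ)*x₁*y₁^(2:ℕ) - (1:ℝ)*x₁^(2:ℕ)*y₁ + (1:ℝ)*M*x₂*y₂ + (1:ℝ)*M*x₁*y₁ + ((1:ℝ)/(2:ℝ))*M^(3:ℕ) + (1:ℝ)*X*x₂*y₂ + (1:ℝ)*X*x₁*y₁ - ((1:ℝ)/(2:ℝ))*X*M^(2:ℕ) - ((1:ℝ)/(2:ℝ))*X^(2:ℕ)*M + ((1:ℝ)/(2:ℝ))*X^(3:ℕ) - ((3:ℝ)/(2:ℝ))*M*Dm + ((1:ℝ)/(2:ℝ))*M*Dp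 + ((1:ℝ)/(2:ℝ))*X*Dm - ((3:ℝ)/(2:ℝ))*X*Dp + (1:ℝ)*Cm + (1:ℝ)*Cp) - (X - x₁ - x₂) * ((3:ℝ)*x₂*y₂^(2:ℕ) - (3:ℝ)*x₂^(2:ℕ)*y₂ + (3:ℝ)*x₁*y₁^(2:ℕ) - (3:ℝ)*x₁^(2:ℕ)*y₁ - (3:ℝ)*M*x₂*y₂ - (3:ℝ)*M*x₁*y₁ - ((1:ℝ)/(2:ℝ))*M^(3:ℕ) + (3:ℝ)*X*x₂*y₂ + (3:ℝ)*X*x₁*y₁ + ((3:ℝ)/(2:ℝ))*X*M^(2:ℕ) - ((3:ℝ)/(2:ℝ))*X^(2:ℕ)*M + ((1:ℝ)/(2:ℝ))*X^(3:ℕ) + ((3:ℝ)/(2:ℝ))*M*Dm + ((3:ℝ)/(2:ℝ))*M*Dp - ((3:ℝ)/(2:ℝ))*X*Dm - ((3:ℝ)/(2:ℝ))*X*Dp - (1:ℝ)*Cm + (1:ℝ)*Cp) := by ring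
    rw [e, hP2, hP4]; nlinarith [hCSp]
  have hmr : (0:ℝ) ≤ -(6:ℝ)*(M - y₁ - y₂)^(2:ℕ)*y₁*y₂ + (4:ℝ)*(M - y₁ - y₂)^(2:ℕ)*y₁*x₂ + (4:ℝ)*(M - y₁ - y₂)^(2:ℕ)*x₁*y₂ - (2:ℝ)*(M - y₁ - y₂)^(2:ℕ)*x₁*x₂ - (3:ℝ)*(M - y₁ - y₂)^(3:ℕ)*y₂ + (2:ℝ)*(M - y₁ - y₂)^(3:ℕ)*x₂ - (3:ℝ)*(M - y₁ - y₂)^(3:ℕ)*y₁ + (2:ℝ)*(M - y₁ - y₂)^(3:ℕ)*x₁ - (M - y₁ - y₂)^(4:ℕ) + (4:ℝ)*(X - x₁ - x₂)*(M - y₁ - y₂)*y₁*y₂ - (2:ℝ)*(X - x₁ - x₂)*(M - y₁ - y₂)*y₁*x₂ - (2:ℝ)*(X - x₁ - x₂)*(M - y₁ - y₂)*x₁*y₂ + (4:ℝ)*(X - x₁ - x₂)*(M - y₁ - y₂)^(2:ℕ)*y₂ - (2:ℝ)*(X - x₁ - x₂)*(M - y₁ - y₂)^(2:ℕ)*x₂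 + (4:ℝ)*(X - x₁ - x₂)*(M - y₁ - y₂)^(2:ℕ)*y₁ - (2:ℝ)*(X - x₁ - x₂)*(M - y₁ - y₂)^(2:ℕ)*x₁ + (2:ℝ)*(X - x₁ - x₂)*(M - y₁ - y₂)^(3:ℕ) - (X - x₁ - x₂)^(2:ℕ)*(M - y₁ - y₂)*y₂ - (X - x₁ - x₂)^(2:ℕ)*(M - y₁ - y₂)*y₁ - (X - x₁ - x₂)^(2:ℕ)*(M - y₁ - y₂)^(2:ℕ) + (3:ℝ)*(M - y₁ - y₂)*(Dm - y₁ ^ 2 - y₂ ^ 2)*y₂ - (2:ℝ)*(M - y₁ - y₂)*(Dm - y₁ ^ 2 - y₂ ^ 2)*x₂ + (3:ℝ)*(M - y₁ - y₂)*(Dm - y₁ ^ 2 - y₂ ^ 2)*y₁ - (2:ℝ)*(M - y₁ - y₂)*(Dm - y₁ ^ 2 - y₂ ^ 2)*x₁ + (M - y₁ - y₂)*(Dp - x₁ ^ 2 - x₂ ^ 2)*y₂ + (M - y₁ - y₂)*(Dp - x₁ ^ 2 - x₂ ^ 2)*y₁ + (3:ℝ)*(M - y₁ - y₂)^(2:ℕ)*(Dm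 - y₁ ^ 2 - y₂ ^ 2) + (M - y₁ - y₂)^(2:ℕ)*(Dp - x₁ ^ 2 - x₂ ^ 2) - (2:ℝ)*(X - x₁ - x₂)*(M - y₁ - y₂)*(Dm - y₁ ^ 2 - y₂ ^ 2) - (2:ℝ)*(Dm - y₁ ^ 2 - y₂ ^ 2)^(2:ℕ) := by
    have e : -(6:ℝ)*(M - y₁ - y₂)^(2:ℕ)*y₁*y₂ + (4:ℝ)*(M - y₁ - y₂)^(2:ℕ)*y₁*x₂ + (4:ℝ)*(M - y₁ - y₂)^(2:ℕ)*x₁*y₂ - (2:ℝ)*(M - y₁ - y₂)^(2:ℕ)*x₁*x₂ - (3:ℝ)*(M - y₁ - y₂)^(3:ℕ)*y₂ + (2:ℝ)*(M - y₁ - y₂)^(3:ℕ)*x₂ - (3:ℝ)*(M - y₁ - y₂)^(3:ℕ)*y₁ + (2:ℝ)*(M - y₁ - y₂)^(3:ℕ)*x₁ - (M - y₁ - y₂)^(4:ℕ) + (4:ℝ)*(X - x₁ - x₂)*(M - y₁ - y₂)*y₁*y₂ - (2:ℝ)*(X - x₁ - x₂)*(M - y₁ - y₂)*y₁*x₂ -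 (2:ℝ)*(X - x₁ - x₂)*(M - y₁ - y₂)*x₁*y₂ + (4:ℝ)*(X - x₁ - x₂)*(M - y₁ - y₂)^(2:ℕ)*y₂ - (2:ℝ)*(X - x₁ - x₂)*(M - y₁ - y₂)^(2:ℕ)*x₂ + (4:ℝ)*(X - x₁ - x₂)*(M - y₁ - y₂)^(2:ℕ)*y₁ - (2:ℝ)*(X - x₁ - x₂)*(M - y₁ - y₂)^(2:ℕ)*x₁ + (2:ℝ)*(X - x₁ - x₂)*(M - y₁ - y₂)^(3:ℕ) - (X - x₁ - x₂)^(2:ℕ)*(M - y₁ - y₂)*y₂ - (X - x₁ - x₂)^(2:ℕ)*(M - y₁ - y₂)*y₁ - (X - x₁ - x₂)^(2:ℕ)*(M - y₁ - y₂)^(2:ℕ) + (3:ℝ)*(M - y₁ - y₂)*(Dm - y₁ ^ 2 - y₂ ^ 2)*y₂ - (2:ℝ)*(M - y₁ - y₂)*(Dm - y₁ ^ 2 - y₂ ^ 2)*x₂ + (3:ℝ)*(M - y₁ - y₂)*(Dm - y₁ ^ 2 - y₂ ^ 2)*y₁ - (2:ℝ)*(M - y₁ - y₂)*(Dm - y₁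 ^ 2 - y₂ ^ 2)*x₁ + (M - y₁ - y₂)*(Dp - x₁ ^ 2 - x₂ ^ 2)*y₂ + (M - y₁ - y₂)*(Dp - x₁ ^ 2 - x₂ ^ 2)*y₁ + (3:ℝ)*(M - y₁ - y₂)^(2:ℕ)*(Dm - y₁ ^ 2 - y₂ ^ 2) + (M - y₁ - y₂)^(2:ℕ)*(Dp - x₁ ^ 2 - x₂ ^ 2) - (2:ℝ)*(X - x₁ - x₂)*(M - y₁ - y₂)*(Dm - y₁ ^ 2 - y₂ ^ 2) - (2:ℝ)*(Dm - y₁ ^ 2 - y₂ ^ 2)^(2:ℕ)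
        = 2 * ((M - y₁ - y₂) * (Cm - y₁ ^ 3 - y₂ ^ 3) - (Dm - y₁ ^ 2 - y₂ ^ 2) ^ 2) - (M - y₁ - y₂) * (-(1:ℝ)*x₂*y₂^(2:ℕ) - (1:ℝ)*x₂^(2:ℕ)*y₂ - (1:ℝ)*x₁*y₁^(2:ℕ) - (1:ℝ)*x₁^(2:ℕ)*y₁ + (1:ℝ)*M*x₂*y₂ + (1:ℝ)*M*x₁*y₁ + ((1:ℝ)/(2:ℝ))*M^(3:ℕ) + (1:ℝ)*X*x₂*y₂ + (1:ℝ)*X*x₁*y₁ - ((1:ℝ)/(2:ℝ))*X*M^(2:ℕ) - ((1:ℝ)/(2:ℝ))*X^(2:ℕ)*M + ((1:ℝ)/(2:ℝ))*X^(3:ℕ) - ((3:ℝ)/(2:ℝ))*M*Dm + ((1:ℝ)/(2:ℝ))*M*Dp + ((1:ℝ)/(2:ℝ))*X*Dm - ((3:ℝ)/(2:ℝ))*X*Dp + (1:ℝ)*Cm + (1:ℝ)*Cp) + (M - y₁ - y₂) * ((3:ℝ)*x₂*y₂^(2:ℕ) - (3:ℝ)*x₂^(2:ℕ)*y₂ +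 (3:ℝ)*x₁*y₁^(2:ℕ) - (3:ℝ)*x₁^(2:ℕ)*y₁ - (3:ℝ)*M*x₂*y₂ - (3:ℝ)*M*x₁*y₁ - ((1:ℝ)/(2:ℝ))*M^(3:ℕ) + (3:ℝ)*X*x₂*y₂ + (3:ℝ)*X*x₁*y₁ + ((3:ℝ)/(2:ℝ))*X*M^(2:ℕ) - ((3:ℝ)/(2:ℝ))*X^(2:ℕ)*M + ((1:ℝ)/(2:ℝ))*X^(3:ℕ) + ((3:ℝ)/(2:ℝ))*M*Dm + ((3:ℝ)/(2:ℝ))*M*Dp - ((3:ℝ)/(2:ℝ))*X*Dm - ((3:ℝ)/(2:ℝ))*X*Dp - (1:ℝ)*Cm + (1:ℝ)*Cp) := by ring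
    rw [e, hP2, hP4]; nlinarith [hCSm]
  have key := reduced_cross_plus_two_EE (X - x₁ - x₂) (M - y₁ - y₂) (Dp - x₁ ^ 2 - x₂ ^ 2) (Dm - y₁ ^ 2 - y₂ ^ 2) x₁ y₁ x₂ y₂ hX1 hM1 hx₁ hy₁ hx₂ hy₂ hKr hpr hmr
  refine le_of_le_of_eq key ?_
  ring

set_option maxHeartbeats 4000000 in
/-- **CONJECTURE N ON 'CROSS + TWO FREE E-ROOTS' CONFIGURATIONS (format (5,3)), WITH (P1).** A centred format-(5,3) configuration in corner
coordinates about a base point `(As, us)` — E-roots `(As + x_e + y_e, us + x_e − y_e)`, F-roots `(As − p_g − q_g, us + q_g − p_g)`, `x, y, p, q ≥ 0`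
(automatically pairwise ample) — in which `E₃, E₄, E₅, F₁, F₂, F₃` lie on the two null lines through the base point (`x_e·y_e = 0`, `p_g·q_g = 0`) while
`E₁` AND `E₂` are ARBITRARY, and which is pure (`P1 = P2 = P4 = 0`), satisfies `G = Q₂ + Q₄ ≥ 0`. Hypotheses = those of
`…CrossPlusOne.conjectureN_53_cross_plus_one` with `x₂·y₂ = 0` deleted. -/
theorem conjectureN_53_cross_plus_two_EE (A₁ A₂ A₃ A₄ A₅ B₁ B₂ B₃ u₁ u₂ u₃ u₄ u₅ v₁ v₂ v₃ As us : ℝ) (x₁ x₂ x₃ x₄ x₅ y₁ y₂ y₃ y₄ y₅ p₁ p₂ p₃ q₁ q₂ q₃ : ℝ)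
    (hA : A₁ + A₂ + A₃ + A₄ + A₅ = B₁ + B₂ + B₃) (hC : u₁ + u₂ + u₃ + u₄ + u₅ = v₁ + v₂ + v₃)
    (hP2 : ((A₁ * u₁ ^ 2 + A₂ * u₂ ^ 2 + A₃ * u₃ ^ 2 + A₄ * u₄ ^ 2 + A₅ * u₅ ^ 2) - (B₁ * v₁ ^ 2 + B₂ * v₂ ^ 2 + B₃ * v₃ ^ 2)) = 0)
    (hP4 : ((u₁ ^ 3 + u₂ ^ 3 + u₃ ^ 3 + u₄ ^ 3 + u₅ ^ 3) - (v₁ ^ 3 + v₂ ^ 3 + v₃ ^ 3)) = 0)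
    (hP1 : ((A₁ ^ 2 * u₁ + A₂ ^ 2 * u₂ + A₃ ^ 2 * u₃ + A₄ ^ 2 * u₄ + A₅ ^ 2 * u₅) - (B₁ ^ 2 * v₁ + B₂ ^ 2 * v₂ + B₃ ^ 2 * v₃)) = 0)
    (hA₁ : A₁ = As + x₁ + y₁) (hA₂ : A₂ = As + x₂ + y₂) (hA₃ : A₃ = As + x₃ + y₃) (hA₄ : A₄ = As + x₄ + y₄) (hA₅ : A₅ = As + x₅ + y₅) (hu₁ : u₁ = us + x₁ - y₁) (hu₂ : u₂ = us + x₂ - y₂) (hu₃ : u₃ = us + x₃ - y₃) (hu₄ : u₄ = us + x₄ - y₄) (hu₅ : u₅ = us + x₅ - y₅) (hB₁ : B₁ = As - p₁ - q₁) (hB₂ : B₂ = As - p₂ - q₂) (hB₃ : B₃ = As - p₃ - q₃) (hv₁ : v₁ = us + q₁ - p₁) (hv₂ : v₂ = us + q₂ - p₂) (hv₃ : v₃ = us + q₃ - p₃)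
    (hx₁ : 0 ≤ x₁) (hx₂ : 0 ≤ x₂) (hx₃ : 0 ≤ x₃) (hx₄ : 0 ≤ x₄) (hx₅ : 0 ≤ x₅) (hy₁ : 0 ≤ y₁) (hy₂ : 0 ≤ y₂) (hy₃ : 0 ≤ y₃) (hy₄ : 0 ≤ y₄) (hy₅ : 0 ≤ y₅) (hp₁ : 0 ≤ p₁) (hp₂ : 0 ≤ p₂) (hp₃ : 0 ≤ p₃) (hq₁ : 0 ≤ q₁) (hq₂ : 0 ≤ q₂) (hq₃ : 0 ≤ q₃)
    (hxy₃ : x₃ * y₃ = 0) (hxy₄ : x₄ * y₄ = 0) (hxy₅ : x₅ * y₅ = 0) (hpq₁ : p₁ * q₁ = 0) (hpq₂ : p₂ * q₂ = 0) (hpq₃ : p₃ * q₃ = 0) :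
    0 ≤ (1 / 2) * ((A₁ ^ 2 + A₂ ^ 2 + A₃ ^ 2 + A₄ ^ 2 + A₅ ^ 2) - (B₁ ^ 2 + B₂ ^ 2 + B₃ ^ 2)) * ((u₁ ^ 2 + u₂ ^ 2 + u₃ ^ 2 + u₄ ^ 2 + u₅ ^ 2) - (v₁ ^ 2 + v₂ ^ 2 + v₃ ^ 2))
        + ((A₁ * u₁ + A₂ * u₂ + A₃ * u₃ + A₄ * u₄ + A₅ * u₅) - (B₁ * v₁ + B₂ * v₂ + B₃ * v₃)) ^ 2
        - 3 * ((A₁ ^ 2 * u₁ ^ 2 + A₂ ^ 2 * u₂ ^ 2 + A₃ ^ 2 * u₃ ^ 2 + A₄ ^ 2 * u₄ ^ 2 + A₅ ^ 2 * u₅ ^ 2) - (B₁ ^ 2 * v₁ ^ 2 + B₂ ^ 2 * v₂ ^ 2 + B₃ ^ 2 * v₃ ^ 2))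
      + (3 * ((u₁ ^ 4 + u₂ ^ 4 + u₃ ^ 4 + u₄ ^ 4 + u₅ ^ 4) - (v₁ ^ 4 + v₂ ^ 4 + v₃ ^ 4)) - (3 / 2) * ((u₁ ^ 2 + u₂ ^ 2 + u₃ ^ 2 + u₄ ^ 2 + u₅ ^ 2) - (v₁ ^ 2 + v₂ ^ 2 + v₃ ^ 2)) ^ 2) := by
  have hG := G_gauge_general A₁ A₂ A₃ A₄ A₅ B₁ B₂ B₃ u₁ u₂ u₃ u₄ u₅ v₁ v₂ v₃ As us (x₁ * y₁) (x₂ * y₂) 0 0 0 0 0 0 hA hC hP2 hP4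
    (by rw [hA₁, hu₁]; ring) (by rw [hA₂, hu₂]; ring) (by rw [hA₃, hu₃]; linear_combination 4 * hxy₃) (by rw [hA₄, hu₄]; linear_combination 4 * hxy₄)
    (by rw [hA₅, hu₅]; linear_combination 4 * hxy₅) (by rw [hB₁, hv₁]; linear_combination 4 * hpq₁) (by rw [hB₂, hv₂]; linear_combination 4 * hpq₂)
    (by rw [hB₃, hv₃]; linear_combination 4 * hpq₃)
  rw [hG]
  have hus : 2 * us = (y₁ + y₂ + y₃ + y₄ + y₅ + q₁ + q₂ + q₃) - (x₁ + x₂ + x₃ + x₄ + x₅ + p₁ + p₂ + p₃) := by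
    have h := hC
    rw [hu₁, hu₂, hu₃, hu₄, hu₅, hv₁, hv₂, hv₃] at h
    linarith
  have hAs : 2 * As = -((x₁ + x₂ + x₃ + x₄ + x₅ + p₁ + p₂ + p₃) + (y₁ + y₂ + y₃ + y₄ + y₅ + q₁ + q₂ + q₃)) := by
    have h := hA
    rw [hA₁, hA₂, hA₃, hA₄, hA₅, hB₁, hB₂, hB₃] at h
    linarith
  subst hA₁ hA₂ hA₃ hA₄ hA₅ hu₁ hu₂ hu₃ hu₄ hu₅ hB₁ hB₂ hB₃ hv₁ hv₂ hv₃
  rw [Mo_corner, T_corner, S_on_cross_plus_two x₁ x₂ x₃ x₄ x₅ y₁ y₂ y₃ y₄ y₅ p₁ p₂ p₃ q₁ q₂ q₃ us As hus hAs hxy₃ hxy₄ hxy₅ hpq₁ hpq₂ hpq₃]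
  have hP2a := (P2_on_cross_plus_two x₁ x₂ x₃ x₄ x₅ y₁ y₂ y₃ y₄ y₅ p₁ p₂ p₃ q₁ q₂ q₃ us As hus hAs hxy₃ hxy₄ hxy₅ hpq₁ hpq₂ hpq₃).symm.trans hP2
  have hP4a := (P4_on_cross_plus_two x₁ x₂ x₃ x₄ x₅ y₁ y₂ y₃ y₄ y₅ p₁ p₂ p₃ q₁ q₂ q₃ us As hus hAs hxy₃ hxy₄ hxy₅ hpq₁ hpq₂ hpq₃).symm.trans hP4
  have hKa : (4:ℝ)*x₂*y₂^(2:ℕ) - (4:ℝ)*x₂^(2:ℕ)*y₂ + (4:ℝ)*x₁*y₁^(2:ℕ) - (4:ℝ)*x₁^(2:ℕ)*y₁ - (4:ℝ)*(y₁ + y₂ + y₃ + y₄ + y₅ + q₁ + q₂ + q₃)*x₂*y₂ - (4:ℝ)*(y₁ + y₂ + y₃ + y₄ + y₅ + q₁ + q₂ + q₃)*x₁*y₁ + (4:ℝ)*(x₁ + x₂ + x₃ + x₄ + x₅ + p₁ + p₂ + p₃)*x₂*y₂ + (4:ℝ)*(x₁ + x₂ + x₃ + x₄ + x₅ + p₁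 + p₂ + p₃)*x₁*y₁ + (2:ℝ)*(x₁ + x₂ + x₃ + x₄ + x₅ + p₁ + p₂ + p₃)*(y₁ + y₂ + y₃ + y₄ + y₅ + q₁ + q₂ + q₃)^(2:ℕ) - (2:ℝ)*(x₁ + x₂ + x₃ + x₄ + x₅ + p₁ + p₂ + p₃)^(2:ℕ)*(y₁ + y₂ + y₃ + y₄ + y₅ + q₁ + q₂ + q₃) + (2:ℝ)*(y₁ + y₂ + y₃ + y₄ + y₅ + q₁ + q₂ + q₃)*((x₁ ^ 2 + x₂ ^ 2 + x₃ ^ 2 + x₄ ^ 2 + x₅ ^ 2) - (p₁ ^ 2 + p₂ ^ 2 + p₃ ^ 2)) - (2:ℝ)*(x₁ + x₂ + x₃ + x₄ + x₅ + p₁ + p₂ + p₃)*((y₁ ^ 2 + y₂ ^ 2 + y₃ ^ 2 + y₄ ^ 2 + y₅ ^ 2) - (q₁ ^ 2 + q₂ ^ 2 + q₃ ^ 2)) = 0 := by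
    rw [← K_on_cross_plus_two x₁ x₂ x₃ x₄ x₅ y₁ y₂ y₃ y₄ y₅ p₁ p₂ p₃ q₁ q₂ q₃ us As hus hAs hxy₃ hxy₄ hxy₅ hpq₁ hpq₂ hpq₃, hP4, hP1]; norm_num
  have hX1 : 0 ≤ (x₁ + x₂ + x₃ + x₄ + x₅ + p₁ + p₂ + p₃) - x₁ - x₂ := by linarith
  have hM1 : 0 ≤ (y₁ + y₂ + y₃ + y₄ + y₅ + q₁ + q₂ + q₃) - y₁ - y₂ := by linarith
  have key := aggregate_cross_plus_two_EE (x₁ + x₂ + x₃ + x₄ + x₅ + p₁ + p₂ + p₃) (y₁ + y₂ + y₃ + y₄ + y₅ + q₁ + q₂ + q₃) ((x₁ ^ 2 + x₂ ^ 2 + x₃ ^ 2 + x₄ ^ 2 + x₅ ^ 2) - (p₁ ^ 2 + p₂ ^ 2 + p₃ ^ 2)) ((y₁ ^ 2 + y₂ ^ 2 + y₃ ^ 2 + y₄ ^ 2 + y₅ ^ 2) - (q₁ ^ 2 + q₂ ^ 2 + q₃ ^ 2)) ((x₁ ^ 3 + x₂ ^ 3 + x₃ ^ 3 + x₄ ^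 3 + x₅ ^ 3) + (p₁ ^ 3 + p₂ ^ 3 + p₃ ^ 3)) ((y₁ ^ 3 + y₂ ^ 3 + y₃ ^ 3 + y₄ ^ 3 + y₅ ^ 3) + (q₁ ^ 3 + q₂ ^ 3 + q₃ ^ 3)) x₁ y₁ x₂ y₂ us hus hx₁ hy₁ hx₂ hy₂ hX1 hM1 hP2a hP4a hKa
    (cauchy_schwarz_H2 x₁ x₂ x₃ x₄ x₅ p₁ p₂ p₃ hx₃ hx₄ hx₅ hp₁ hp₂ hp₃) (cauchy_schwarz_V2 y₁ y₂ y₃ y₄ y₅ q₁ q₂ q₃ hy₃ hy₄ hy₅ hq₁ hq₂ hq₃)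
  refine le_of_le_of_eq key ?_
  ring

end Summit.HodgeConjecture.HodgeConjecture.WeilClassTestFormatFiveThreeCrossPlusTwoEE
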